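import Mathlib
import Literature.Analysis.Fourier.HilbertTransformLineL2
import Literature.Analysis.Fourier.HilbertTransformLineMoment
import HarnessLib

/-!
# The Hilbert transform is an isometry of the weighted space `L²((c + ξ²) dξ)` on odd functions

`Literature/Analysis/Fourier`. Combination of the `L²` isometry `‖Hf‖₂ = ‖f‖₂`
(`HilbertTransformLineL2.lean`, [cite: Grafakos2014, eq. (5.1.14)]) with the odd-function commutator identity
`H[y f(y)](x) = x·Hf(x)` (`hilbertTransform_mul_id_of_odd`, [cite: King2009HilbertTransforms2, eq. (19.151)]):
for an ODD real `f` with `f, y·f(y) ∈ L¹ ∩ L²` and a.e.-integrable symmetric p.v. integrand,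

  `∫ (c + x²)·(Hf)(x)² dx = ∫ (c + x²)·f(x)² dx`     (`integral_weight_mul_hilbertTransform_sq_eq`),

i.e. `H : L²_{c+ξ², odd} → L²_{c+ξ², even}` is an isometry for every real `c` (no Muckenhoupt constant, no loss),
together with `x·Hf(x) ∈ L²` (`memLp_two_id_mul_hilbertTransform`) and `∫ (x·Hf)² = ∫ (x·f)²`. The p.v. integrand of
`y·f(y)` is integrable wherever that of `f` is (`integrableOn_symmIntegrand_id_mul`), so no extra principal-value
hypothesis is needed. MOTIVATION (cell ns-blowup, zone Z3): this is identity (1b)+(1a) of the SHEET-ℝ certificate frame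
(`HOME/selfsim/SHEET-R-FRAME-NOTE-v2.md` §1: the space `X = H¹_{2+ξ²}`; velocity bound (1c) and the Newton–Kantorovich
Lipschitz constant of §3 rest on it). No definitions. WHAT THIS IS NOT: not Navier–Stokes.
-/

namespace Literature.Analysis.Fourier

open _root_.MeasureTheory Set Filter
open scoped Real Topology ENNReal

/-- The symmetric p.v. integrand of `y ↦ y·f(y)` at `x` is integrable on `(0,∞)` as soon as that of `f` is
(and `f ∈ L¹`): `((x−t)f(x−t) − (x+t)f(x+t))/t = x·(f(x−t) − f(x+t))/t − (f(x−t) + f(x+t))`.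
[cite: King2009HilbertTransforms2, eq. (19.150) (moment formula, its derivation)] -/
theorem integrableOn_symmIntegrand_id_mul {f : ℝ → ℝ} {x : ℝ} (hf : Integrable f)
    (hint : IntegrableOn (fun t => (f (x - t) - f (x + t)) / t) (Ioi 0)) :
    IntegrableOn (fun t => ((x - t) * f (x - t) - (x + t) * f (x + t)) / t) (Ioi 0) := by
  have hA : Integrable (fun t => f (x - t)) := hf.comp_sub_left x
  have hB : Integrable (fun t => f (x + t)) := hf.comp_add_left x
  have h : IntegrableOn (fun t => x * ((f (x - t) - f (x + t)) / t) - (f (x - t) + f (x + t))) (Ioi 0) :=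
    (hint.const_mul x).sub (hA.add hB).integrableOn
  refine h.congr_fun (fun t ht => ?_) measurableSet_Ioi
  have ht0 : t ≠ 0 := ne_of_gt ht
  field_simp
  ring

/-- **`x·Hf(x)` is square integrable** for odd `f` with `f, y f(y) ∈ L¹ ∩ L²` and a.e.-integrable p.v. integrand
(it equals `H[y f(y)](x)` a.e.). [cite: Grafakos2014, eq. (5.1.14)] -/
theorem memLp_two_id_mul_hilbertTransform {f : ℝ → ℝ} (hf : Integrable f) (hodd : ∀ y, f (-y) = -f y)
    (hxf : Integrable (fun y => y * f y)) (hxf2 : MemLp (fun y => y * f y) 2)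
    (hint : ∀ᵐ x : ℝ, IntegrableOn (fun t => (f (x - t) - f (x + t)) / t) (Ioi 0)) :
    MemLp (fun x => x * hilbertTransform f x) 2 := by
  have hint' : ∀ᵐ x : ℝ, IntegrableOn (fun t => ((x - t) * f (x - t) - (x + t) * f (x + t)) / t) (Ioi 0) := by
    filter_upwards [hint] with x hx using integrableOn_symmIntegrand_id_mul hf hx
  have hH := memLp_two_hilbertTransform hxf hxf2 hint'
  refine hH.ae_eq ?_
  filter_upwards [hint] with x hx
  exact hilbertTransform_mul_id_of_odd hf hodd hx

/-- **`∫ (x·Hf(x))² dx = ∫ (x·f(x))² dx`** for odd `f` with `f, y f(y) ∈ L¹ ∩ L²` and a.e.-integrable p.v. integrand.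
[cite: Grafakos2014, eq. (5.1.14)] -/
theorem integral_sq_id_mul_hilbertTransform_eq {f : ℝ → ℝ} (hf : Integrable f) (hodd : ∀ y, f (-y) = -f y)
    (hxf : Integrable (fun y => y * f y)) (hxf2 : MemLp (fun y => y * f y) 2)
    (hint : ∀ᵐ x : ℝ, IntegrableOn (fun t => (f (x - t) - f (x + t)) / t) (Ioi 0)) :
    ∫ x, (x * hilbertTransform f x) ^ 2 = ∫ x, (x * f x) ^ 2 := by
  have hint' : ∀ᵐ x : ℝ, IntegrableOn (fun t => ((x - t) * f (x - t) - (x + t) * f (x + t)) / t) (Ioi 0) := by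
    filter_upwards [hint] with x hx using integrableOn_symmIntegrand_id_mul hf hx
  rw [← integral_hilbertTransform_sq_eq hxf hxf2 hint']
  refine integral_congr_ae ?_
  filter_upwards [hint] with x hx
  rw [hilbertTransform_mul_id_of_odd hf hodd hx]

/-- **Weighted isometry**: for odd `f` with `f, y f(y) ∈ L¹ ∩ L²` and a.e.-integrable symmetric p.v. integrand, and
any real `c`, `∫ (c + x²)(Hf)(x)² dx = ∫ (c + x²) f(x)² dx` — `H` is an isometry of `L²((c+ξ²)dξ)` on odd functions.
[cite: Grafakos2014, eq. (5.1.14)] [cite: King2009HilbertTransforms2, eq. (19.151)] -/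
theorem integral_weight_mul_hilbertTransform_sq_eq {f : ℝ → ℝ} (hf : Integrable f) (hodd : ∀ y, f (-y) = -f y)
    (hf2 : MemLp f 2) (hxf : Integrable (fun y => y * f y)) (hxf2 : MemLp (fun y => y * f y) 2)
    (hint : ∀ᵐ x : ℝ, IntegrableOn (fun t => (f (x - t) - f (x + t)) / t) (Ioi 0)) (c : ℝ) :
    ∫ x, (c + x ^ 2) * (hilbertTransform f x) ^ 2 = ∫ x, (c + x ^ 2) * (f x) ^ 2 := by
  have hH2 : Integrable (fun x => (hilbertTransform f x) ^ 2) :=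
    (memLp_two_hilbertTransform hf hf2 hint).integrable_sq
  have hxH2 : Integrable (fun x => (x * hilbertTransform f x) ^ 2) :=
    (memLp_two_id_mul_hilbertTransform hf hodd hxf hxf2 hint).integrable_sq
  have hf2' : Integrable (fun x => (f x) ^ 2) := hf2.integrable_sq
  have hxf2' : Integrable (fun x => (x * f x) ^ 2) := hxf2.integrable_sq
  have e1 : (fun x => (c + x ^ 2) * (hilbertTransform f x) ^ 2) =
      fun x => c * (hilbertTransform f x) ^ 2 + (x * hilbertTransform f x) ^ 2 := by
    funext x; ring
  have e2 : (fun x => (c + x ^ 2) * (f x) ^ 2) = fun x => c * (f x) ^ 2 + (x * f x) ^ 2 := by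
    funext x; ring
  rw [e1, e2, integral_add (hH2.const_mul c) hxH2, integral_add (hf2'.const_mul c) hxf2', integral_const_mul,
    integral_const_mul, integral_hilbertTransform_sq_eq hf hf2 hint,
    integral_sq_id_mul_hilbertTransform_eq hf hodd hxf hxf2 hint]

end Literature.Analysis.Fourier
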